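import Summits.CriticalPhenomena.SAWScalingLimit.Theorems.ShellCrossingBound.Negative.OfEventualTight

/-!
# `SurgeryReduction` (stmt-CriticalPhenomena-4731): the glue is implied by — and, given `TightOfShellCrossing`, is a restatement of — the route's target

Support file for the glue item
`Summit.CriticalPhenomena.SAWScalingLimit.Theses.SAWRenewalTightness.SurgeryReduction`
(`AnnularMassDecay → TubeLowerBound → ShellCrossingBound`, route SAWRenewalTightness).

* `not_eventualTight_of_not_surgeryReduction` — `¬ SurgeryReduction → ¬ EventualTight`, i.e.
  `EventualTight → SurgeryReduction` in negative form (so that the audit does not read it as a conditional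
  proof of the item): by `ShellCrossingBound.Negative.not_eventualTight_of_not_shellCrossingBound` (the
  threshold `k` of `ShellCrossingBound` is free per shell, so tightness of the critical SAW laws already gives
  the bound) the conclusion of the glue follows from the route's rank-0 target alone, whatever the antecedents;
  in particular the glue cannot be refuted short of refuting tightness of the critical `ℤ²` SAW.
* `surgeryReduction_iff_of_tightOfShellCrossing` — under the support item `TightOfShellCrossing`
  (`ShellCrossingBound → EventualTight`, the proved Aizenman–Burchard criterion), the glue is EQUIVALENT to
  `AnnularMassDecay → TubeLowerBound → EventualTight`: it asks to derive tightness of the critical `ℤ²` SAW in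
  every Dobrushin domain from the two lattice estimates r3, r4 — the content of the route, not a glue step.

Both are pure logic over in-tree theorems. [folklore]
-/

namespace Summit.CriticalPhenomena.SAWScalingLimit.Theorems.SurgeryReduction

open Summit.CriticalPhenomena.SAWScalingLimit.Theses.SAWRenewalTightness

/-- **The glue is implied by the target** (negative form): `¬ SurgeryReduction → ¬ EventualTight`
(indeed `EventualTight → ShellCrossingBound`, in tree in negative form). [folklore] -/
theorem not_eventualTight_of_not_surgeryReduction (h : ¬ SurgeryReduction) : ¬ EventualTight :=
  fun hT => h fun _ _ => Classical.byContradiction fun hn =>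
    ShellCrossingBound.Negative.not_eventualTight_of_not_shellCrossingBound hn hT

/-- **Given `TightOfShellCrossing`, the glue is "r3 and r4 imply the target"**:
`SurgeryReduction ↔ (AnnularMassDecay → TubeLowerBound → EventualTight)`. [folklore] -/
theorem surgeryReduction_iff_of_tightOfShellCrossing (h : TightOfShellCrossing) :
    SurgeryReduction ↔ (AnnularMassDecay → TubeLowerBound → EventualTight) :=
  ⟨fun hs hA hT => h (hs hA hT), fun hs hA hT => Classical.byContradiction fun hn =>
    ShellCrossingBound.Negative.not_eventualTight_of_not_shellCrossingBound hn (hs hA hT)⟩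

end Summit.CriticalPhenomena.SAWScalingLimit.Theorems.SurgeryReduction
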